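import Summits.HubbardSuperconductivity.HubbardSuperconductivity.Theorems.AnisotropyChordTransferFibre3RowDRhoBound
import Summits.HubbardSuperconductivity.HubbardSuperconductivity.Theorems.AnisotropyChordTransferFibre3RowCCellSound
import Summits.HubbardSuperconductivity.HubbardSuperconductivity.Theorems.AnisotropyChordTransferFibre3RowDLowGRow

/-!
# Route `AnisotropyChord` / H0 rotor rung, row D (KT-2a): the ROW-D CELL CHECK (Stage 1) and its SOUNDNESS ⇒ `lowG ≤ a_D·η_eff·U`

The end of the row-D Stage-1 program (p1 g29 memo ROWD-DESIGN-g29 §6, p1 g30).  Normalisation: `R̂′(k̄) = V²t·ρ_k` with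
`|ρ_k| ≤ |x_k| + Maj_k` (`rhat_norm_le`; `R̂′` real), `den(k̄) = t·(ê_k − τ)` (★ `denHE`, ★ `eval_denHE`; `ê_k` from the `ŵ`-atoms),
`τ := T⁺/θ² ∈ [τlo, τhi]` (rationals, certified on p2's FINAL box by ★ `tauCheck` via `RowC.tauE`, ★ `tau_of_tauCheck`), `ê_k ≥ 2ê₁ > τhi`
(low-set clause `den ≥ 2ε₁ − T⁺` + the box check `τhi − 2ê₁ ≤ −10⁻³`), `a_D·η_eff·U = V²t·3π²·a_D·ν·τ ≥ V²t·3π²a_Dν·τlo`.  Hence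
★ `rowDCheck c a₁ a₂ aD τlo τhi pi` := `0 ≤ aD ∧ 0 ≤ τlo ∧` on the row-D box: `τhi − 2ê₁ ≤ −10⁻³` and
`Σ_{k ∈ lowList} (|x_k| + majE)²/(ê_k − τhi) − 3π²·aD·ν·τlo ≤ 0` (ONE `rexprLeOn`), and
★★★ `lowG_of_rowDCheck`: `rowDCheck = true`, `tauCheck = true`, `c.check`, ground profile of `(L ≥ 128, 0 ≤ Δ < 1)` located in the cell
⟹ `lowGForm L Δ f ≤ aD·η_eff·U` — the `hKT2a` hypothesis of `gm3_of_cell` on the cell; and the PER-CLASS form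
★★★ `lowG_of_classChecks` (a budget table: 45 small kernel checks `classCheck … k b_k` + a rational budget sum + `e1Check` + `tauCheck`).
Prover seat `hubbard-h0-rotor-p1` g30 (route lead); helper for piece A = stmt-HubbardSuperconductivity-23918 of rung 19089
(`--supports`, helper class).  Nothing here proves superconductivity in the Hubbard model; ONE row of ONE conditional reduction, cell by cell;
the rotor TARGET as originally worded stays FALSE (g15 verdict).  Tree imports only; no sorry.
-/

set_option linter.dupNamespace false
set_option autoImplicit false

open scoped BigOperators
open Literature.Analysis.ValidatedNumerics
namespace Summit.HubbardSuperconductivity.HubbardSuperconductivity.Theorems.AnisotropyChord.Transfer.Fibre3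
namespace RowD
open RowC L2.N1
variable (L : ℕ) [NeZero L]
/-! ## The hatted denominators `ê_k` -/
/-- `ŵ_{|m|}` (`0` for `m = 0`). -/
def whE (m : ℤ) : RExpr := if m = 0 then cst 0 else wE m.natAbs

/-- `ε̂(q) = ŵ_{|q₁|} + ŵ_{|q₂|}`. -/
def epsHE (q : ℤ × ℤ) : RExpr := .add (whE q.1) (whE q.2)

/-- `ê_k := (den(k̄) + T)/θ² = ε̂(x̂ − k₂ − k₃) + ε̂(k₂) + ε̂(k₃) − ŵ₁`. -/
def denHE (k₂ k₃ : ℤ × ℤ) : RExpr := .sub (.add (.add (epsHE (exI - k₂ - k₃)) (epsHE k₂)) (epsHE k₃)) (wE 1)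

/-- all six components at most `3` in absolute value. -/
def denOk (k₂ k₃ : ℤ × ℤ) : Bool :=
  decide ((exI - k₂ - k₃).1.natAbs ≤ 3) && decide ((exI - k₂ - k₃).2.natAbs ≤ 3) && decide (k₂.1.natAbs ≤ 3)
    && decide (k₂.2.natAbs ≤ 3) && decide (k₃.1.natAbs ≤ 3) && decide (k₃.2.natAbs ≤ 3)

section den
variable (Δ lam2 : ℝ) (f : Tor L → ℝ)
/-- `θ²·ŵ_{|m|} = 1 − cos(mθ)` (`|m| ≤ 3`, `L ≥ 3`). [folklore] -/
theorem eval_whE (hL : 3 ≤ L) {m : ℤ} (hm : m.natAbs ≤ 3) :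
    (2 * Real.pi / L) ^ 2 * (whE m).eval (xTrueD L Δ lam2 f) = 1 - Real.cos ((m : ℝ) * (2 * Real.pi / L)) := by
  have hLpos : (0 : ℝ) < L := by exact_mod_cast (show 0 < L by omega)
  have ht : (2 * Real.pi / L : ℝ) ^ 2 ≠ 0 := by positivity
  unfold whE
  by_cases h0 : m = 0
  · rw [if_pos h0, h0]; simp [cst, RExpr.eval]
  · rw [if_neg h0, wD_eval L Δ lam2 f (Int.natAbs_pos.mpr h0) hm]; field_simp

/-- `θ²·ε̂(q) = ε(q̄)` (components `≤ 3`). [folklore] -/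
theorem eval_epsHE (hL : 3 ≤ L) {q : ℤ × ℤ} (h1 : q.1.natAbs ≤ 3) (h2 : q.2.natAbs ≤ 3) :
    (2 * Real.pi / L) ^ 2 * (epsHE q).eval (xTrueD L Δ lam2 f) = epsT L (B1.toTor L q) := by
  have e := B1.two_epsT_intCast L q
  have hq : B1.toTor L q = ((((q.1 : ℤ)) : ZMod L), (((q.2 : ℤ)) : ZMod L)) := rfl
  rw [hq]
  simp only [epsHE, RExpr.eval, mul_add, eval_whE L Δ lam2 f hL h1, eval_whE L Δ lam2 f hL h2]
  rw [mul_comm ((q.1 : ℤ) : ℝ), mul_comm ((q.2 : ℤ) : ℝ)]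
  linarith

/-- ★ `θ²·ê_k = den(T; k̄₂, k̄₃) + T` (any `T`; `denOk k`, `L ≥ 3`). [folklore] -/
theorem eval_denHE (hL : 3 ≤ L) {k₂ k₃ : ℤ × ℤ} (hok : denOk k₂ k₃ = true) (T : ℝ) :
    (2 * Real.pi / L) ^ 2 * (denHE k₂ k₃).eval (xTrueD L Δ lam2 f) = den L T (B1.toTor L k₂) (B1.toTor L k₃) + T := by
  simp only [denOk, Bool.and_eq_true, decide_eq_true_eq] at hok
  obtain ⟨⟨⟨⟨⟨a1, a2⟩, b1⟩, b2⟩, c1⟩, c2⟩ := hok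
  have hK : K1 L - B1.toTor L k₂ - B1.toTor L k₃ = B1.toTor L (exI - k₂ - k₃) := by
    rw [K1_eq_toTor, ← RowC.toTor_sub, ← RowC.toTor_sub]; rfl
  have h1 : (1 : ℤ).natAbs ≤ 3 := by decide
  have e1 : eps1 L = (2 * Real.pi / L) ^ 2 * (wE 1).eval (xTrueD L Δ lam2 f) := by
    have := wD_eval L Δ lam2 f (m := 1) (by decide) h1
    simp only [Int.natAbs_one] at this
    rw [this]; unfold eps1
    have hLpos : (0 : ℝ) < L := by exact_mod_cast (show 0 < L by omega)
    have ht : (2 * Real.pi / L : ℝ) ^ 2 ≠ 0 := by positivity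
    field_simp; simp
  unfold den
  rw [hK, ← eval_epsHE L Δ lam2 f hL a1 a2, ← eval_epsHE L Δ lam2 f hL b1 b2, ← eval_epsHE L Δ lam2 f hL c1 c2, e1]
  simp only [denHE, RExpr.eval]
  ring
end den

/-! ## The side conditions hold on the whole low list -/
/-- every low-list point satisfies `rhoOk` and `denOk` (kernel decision). [folklore] -/
theorem lowList_ok : (lowList.all fun kk => rhoOk kk.1 kk.2 && denOk kk.1 kk.2) = true := by decide

/-- pointwise form. [folklore] -/
theorem ok_of_mem {kk : (ℤ × ℤ) × (ℤ × ℤ)} (h : kk ∈ lowList) : rhoOk kk.1 kk.2 = true ∧ denOk kk.1 kk.2 = true := by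
  have := List.all_eq_true.mp lowList_ok kk h
  simpa [Bool.and_eq_true] using this

/-! ## The program -/
/-- one class: `(|x| + majE)²/(ê_k − τhi)` (`x` = the real part of the closed pair `rhoE`). -/
def termE (τlo τhi : ℚ) (k₂ k₃ : ℤ × ℤ) : RExpr :=
  .mul (.sq (.add (.abs (rhoE k₂ k₃).1) (majE τlo τhi k₂ k₃))) (.inv (.sub (denHE k₂ k₃) (cst τhi)))

/-- the whole row: `Σ_{lowList} termE − 3π²·aD·ν·τlo` (claim `≤ 0`). -/
def totalE (aD τlo τhi : ℚ) : RExpr :=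
  .sub (sumE (lowList.map fun kk => termE τlo τhi kk.1 kk.2)) (.mul (.mul (cst (3 * aD * τlo)) vPi2) vNu)

/-- ★ THE ROW-D CELL CHECK (Stage 1): `0 ≤ aD`, `0 ≤ τlo`, and on the row-D box `τhi − 2ê₁ ≤ −10⁻³`, `totalE ≤ 0`. -/
def rowDCheck (c : L2.NamedCell) (a1 a2 aD τlo τhi : ℚ) (pi : ℕ × ℕ) : Bool :=
  decide (0 ≤ aD) && decide (0 ≤ τlo) &&
    match rowDBox c a1 a2 pi with
    | none => false
    | some B => rexprLeOn (.sub (cst τhi) (.mul (cst 2) vE1)) (-1 / 1000) B pi && rexprLeOn (totalE aD τlo τhi) 0 B pi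

/-- ★ THE `τ` CHECK on p2's final box: `P̂ ≥ 10⁻⁶`, `τlo ≤ tauE ≤ τhi` (`tauE = 3ν − (3/2)Q̂₁/P̂ = T⁺/θ²`). -/
def tauCheck (c : L2.NamedCell) (a1 a2 τlo τhi : ℚ) (pi : ℕ × ℕ) : Bool :=
  match cellFinalBoxC c a1 a2 2 pi with
  | none => false
  | some F => rexprLeOn (.neg yP) (-1 / 1000000) F pi && rexprLeOn (.sub tauE (cst τhi)) 0 F pi
      && rexprLeOn (.sub (cst τlo) tauE) 0 F pi

/-! ## Soundness -/

section sound
variable (Δ lam2 : ℝ) (f : Tor L → ℝ)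

/-- ★ `tauCheck ⇒ τlo·θ² ≤ T⁺ ≤ τhi·θ²` at a ground profile located in the cell. [folklore] -/
theorem tau_of_tauCheck (c : L2.NamedCell) (a1 a2 τlo τhi : ℚ) (pi : ℕ × ℕ)
    (hchk : tauCheck c a1 a2 τlo τhi pi = true) (hc : c.check = true) (hL : 128 ≤ L)
    (hΔ0 : 0 ≤ Δ) (hΔ1 : Δ < 1) (hf : IsGroundTwoMagnon L Δ lam2 f)
    (hν1 : (c.n1 : ℝ) / c.νd ≤ lam2 / (2 * Real.pi / L) ^ 2) (hν2 : lam2 / (2 * Real.pi / L) ^ 2 ≤ (c.n2 : ℝ) / c.νd)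
    (ha1 : ((a1 : ℚ) : ℝ) ≤ Δ * f (K1 L)) (ha2 : Δ * f (K1 L) ≤ ((a2 : ℚ) : ℝ)) :
    (τlo : ℝ) * (2 * Real.pi / L) ^ 2 ≤ Tplus L Δ f ∧ Tplus L Δ f ≤ (τhi : ℝ) * (2 * Real.pi / L) ^ 2 := by
  have hLpos : (0 : ℝ) < L := by exact_mod_cast (show 0 < L by omega)
  have ht : 0 < (2 * Real.pi / L : ℝ) ^ 2 := by positivity
  unfold tauCheck at hchk
  split at hchk
  · exact absurd hchk (by simp)
  · rename_i F hF
    simp only [Bool.and_eq_true] at hchk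
    obtain ⟨⟨hP, hhi⟩, hlo⟩ := hchk
    obtain ⟨y, hmem, g0, -, g2, -, -, g6, g8⟩ :=
      finalVec_mem_of_cellFinalBoxC L c a1 a2 pi hF hc hL hΔ0 hΔ1 hf hν1 hν2 ha1 ha2
    have eP := rexprLeOn_sound hP _ hmem
    have ehi := rexprLeOn_sound hhi _ hmem
    have elo := rexprLeOn_sound hlo _ hmem
    simp only [yP, RExpr.eval] at eP
    simp only [RExpr.eval, cst, eval_tauE] at ehi elo
    push_cast at eP ehi elo
    have hvP : 0 < ((2 * Real.pi / L) ^ 2) ^ 3 * ∑ k : Tor L, F2 L f k ^ 3 := by rw [← g6]; linarith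
    have hT := Tplus_eq_tau L (by omega) hf hvP
    rw [← g6, ← g8, ← g2] at hT
    rw [hT]
    constructor <;> nlinarith

/-- the true row-D vector lies in the row-D box (prefix membership + zero tail). [folklore] -/
theorem rowDBox_mem (c : L2.NamedCell) (a1 a2 : ℚ) (pi : ℕ × ℕ) {B' : Box}
    (hB' : rowDBox c a1 a2 pi = some B') (hc : c.check = true) (hL : 128 ≤ L)
    (hΔ0 : 0 ≤ Δ) (hΔ1 : Δ < 1) (hf : IsGroundTwoMagnon L Δ lam2 f)
    (hν1 : (c.n1 : ℝ) / c.νd ≤ lam2 / (2 * Real.pi / L) ^ 2) (hν2 : lam2 / (2 * Real.pi / L) ^ 2 ≤ (c.n2 : ℝ) / c.νd)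
    (ha1 : ((a1 : ℚ) : ℝ) ≤ Δ * f (K1 L)) (ha2 : Δ * f (K1 L) ≤ ((a2 : ℚ) : ℝ)) :
    B'.mem (xTrueD L Δ lam2 f) := by
  obtain ⟨hP, hlen⟩ := rowDBox_pmem L c a1 a2 pi hB' hc hL hΔ0 hΔ1 hf hν1 hν2 ha1 ha2
  intro i
  by_cases hi : i < B'.length
  · exact hP i hi
  · have hz : xTrueD L Δ lam2 f i = 0 := by
      unfold xTrueD; rw [if_neg (by omega), if_neg (by omega)]
    rw [hz]
    unfold Box.ivl
    rw [List.getD_eq_getElem?_getD, List.getElem?_eq_none (by omega)]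
    simp

/-- one class: `|R̂′(k̄)|²/(V²·den(k̄)) ≤ V²t·termE.eval`. [folklore] -/
theorem class_le (hL : 128 ≤ L) (hΔ0 : 0 ≤ Δ) (hΔ1 : Δ < 1) (hf : IsGroundTwoMagnon L Δ lam2 f)
    (τlo τhi : ℚ) (hτlo : (τlo : ℝ) * (2 * Real.pi / L) ^ 2 ≤ Tplus L Δ f) (hτhi : Tplus L Δ f ≤ (τhi : ℝ) * (2 * Real.pi / L) ^ 2)
    (he1 : (τhi : ℝ) - 2 * (eps1 L / (2 * Real.pi / L) ^ 2) ≤ -1 / 1000)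
    {kk : (ℤ × ℤ) × (ℤ × ℤ)} (hkk : kk ∈ lowList) :
    Complex.normSq (cfgDFT L (resid L Δ f) (B1.toTor L kk.1) (B1.toTor L kk.2))
        / (((L : ℝ) ^ 2) ^ 2 * den L (Tplus L Δ f) (B1.toTor L kk.1) (B1.toTor L kk.2))
      ≤ ((L : ℝ) ^ 2) ^ 2 * (2 * Real.pi / L) ^ 2 * (termE τlo τhi kk.1 kk.2).eval (xTrueD L Δ lam2 f) := by
  have hLpos : (0 : ℝ) < L := by exact_mod_cast (show 0 < L by omega)
  have ht : 0 < (2 * Real.pi / L : ℝ) ^ 2 := by positivity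
  have hV : (0 : ℝ) < (L : ℝ) ^ 2 := by positivity
  obtain ⟨hok, hden⟩ := ok_of_mem hkk
  -- the norm bound
  have hR := rhat_norm_le L Δ lam2 f hL hΔ0 hΔ1 hf τlo τhi hτlo hτhi hok
  set A : ℝ := |(rhoE kk.1 kk.2).1.eval (xTrueD L Δ lam2 f)| + (majE τlo τhi kk.1 kk.2).eval (xTrueD L Δ lam2 f) with hA
  -- the denominator
  have hmem : (B1.toTor L kk.1, B1.toTor L kk.2) ∈ lowSet L := mem_lowSet_of_mem_lowList L (by omega) hkk
  have hdlow := den_ge_of_mem_lowSet L (by omega) (Tplus L Δ f) hmem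
  have ed := eval_denHE L Δ lam2 f (by omega) hden (Tplus L Δ f)
  set dh : ℝ := (denHE kk.1 kk.2).eval (xTrueD L Δ lam2 f) with hdh
  have hden_eq : den L (Tplus L Δ f) (B1.toTor L kk.1) (B1.toTor L kk.2) = (2 * Real.pi / L) ^ 2 * dh - Tplus L Δ f := by
    rw [hdh]; linarith [ed]
  have hpos : 0 < dh - τhi := by
    have h2 : 2 * eps1 L ≤ (2 * Real.pi / L) ^ 2 * dh := by simp only at hdlow; linarith [hden_eq]
    have he : eps1 L / (2 * Real.pi / L) ^ 2 ≤ dh / 2 := by rw [div_le_iff₀ ht]; linarith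
    linarith
  have hden_lb : (2 * Real.pi / L) ^ 2 * (dh - τhi) ≤ den L (Tplus L Δ f) (B1.toTor L kk.1) (B1.toTor L kk.2) := by
    rw [hden_eq]; nlinarith
  -- evaluate termE
  have eT : (termE τlo τhi kk.1 kk.2).eval (xTrueD L Δ lam2 f) = A ^ 2 * (dh - τhi)⁻¹ := by
    simp only [termE, RExpr.eval, cst, hA, hdh]
  rw [eT, Complex.normSq_eq_norm_sq]
  have hsq : ‖cfgDFT L (resid L Δ f) (B1.toTor L kk.1) (B1.toTor L kk.2)‖ ^ 2 ≤ (((L : ℝ) ^ 2) ^ 2 * (2 * Real.pi / L) ^ 2 * A) ^ 2 :=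
    pow_le_pow_left₀ (norm_nonneg _) hR 2
  calc ‖cfgDFT L (resid L Δ f) (B1.toTor L kk.1) (B1.toTor L kk.2)‖ ^ 2
          / (((L : ℝ) ^ 2) ^ 2 * den L (Tplus L Δ f) (B1.toTor L kk.1) (B1.toTor L kk.2))
      ≤ (((L : ℝ) ^ 2) ^ 2 * (2 * Real.pi / L) ^ 2 * A) ^ 2 / (((L : ℝ) ^ 2) ^ 2 * ((2 * Real.pi / L) ^ 2 * (dh - τhi))) := by
        apply div_le_div₀ (by positivity) hsq (by positivity)
        exact mul_le_mul_of_nonneg_left hden_lb (by positivity)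
    _ = ((L : ℝ) ^ 2) ^ 2 * (2 * Real.pi / L) ^ 2 * (A ^ 2 * (dh - τhi)⁻¹) := by
        field_simp

/-- `Σ_{lowSet}` as a list sum over `lowList`. [folklore] -/
theorem lowGForm_eq_listsum (hL : 8 ≤ L) :
    lowGForm L Δ f = (lowList.map fun kk =>
      Complex.normSq (cfgDFT L (resid L Δ f) (B1.toTor L kk.1) (B1.toTor L kk.2))
        / (((L : ℝ) ^ 2) ^ 2 * den L (Tplus L Δ f) (B1.toTor L kk.1) (B1.toTor L kk.2))).sum := by
  unfold lowGForm
  rw [sum_lowSet_eq L hL, List.sum_toFinset _ lowList_nodup]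

/-- a list sum bounded termwise. [folklore] -/
theorem listsum_le {ι : Type*} (l : List ι) (a b : ι → ℝ) (h : ∀ i ∈ l, a i ≤ b i) :
    (l.map a).sum ≤ (l.map b).sum := by
  induction l with
  | nil => simp
  | cons x t ih =>
      simp only [List.map_cons, List.sum_cons]
      exact add_le_add (h x (by simp)) (ih fun i hi => h i (by simp [hi]))

/-- ★★★ **A PASSING ROW-D CHECK (+ `τ` CHECK) GIVES THE (KT-2a″) BOUND `lowG ≤ a_D·η_eff·U` FOR EVERY `L ≥ 128` ON THE CELL.** -/
theorem lowG_of_rowDCheck (c : L2.NamedCell) (a1 a2 aD τlo τhi : ℚ) (pi piT : ℕ × ℕ)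
    (hchk : rowDCheck c a1 a2 aD τlo τhi pi = true) (hτ : tauCheck c a1 a2 τlo τhi piT = true)
    (hc : c.check = true) (hL : 128 ≤ L)
    (hΔ0 : 0 ≤ Δ) (hΔ1 : Δ < 1) (hf : IsGroundTwoMagnon L Δ lam2 f)
    (hν1 : (c.n1 : ℝ) / c.νd ≤ lam2 / (2 * Real.pi / L) ^ 2) (hν2 : lam2 / (2 * Real.pi / L) ^ 2 ≤ (c.n2 : ℝ) / c.νd)
    (ha1 : ((a1 : ℚ) : ℝ) ≤ Δ * f (K1 L)) (ha2 : Δ * f (K1 L) ≤ ((a2 : ℚ) : ℝ)) :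
    lowGForm L Δ f ≤ (aD : ℝ) * etaEff L lam2 * Uunit L Δ f := by
  have hLpos : (0 : ℝ) < L := by exact_mod_cast (show 0 < L by omega)
  have ht : 0 < (2 * Real.pi / L : ℝ) ^ 2 := by positivity
  have hV : (0 : ℝ) < (L : ℝ) ^ 2 := by positivity
  obtain ⟨hτlo, hτhi⟩ := tau_of_tauCheck L Δ lam2 f c a1 a2 τlo τhi piT hτ hc hL hΔ0 hΔ1 hf hν1 hν2 ha1 ha2
  -- unpack the check
  unfold rowDCheck at hchk
  simp only [Bool.and_eq_true, decide_eq_true_eq] at hchk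
  obtain ⟨⟨haD, hτlo0⟩, hrest⟩ := hchk
  split at hrest
  · exact absurd hrest (by simp)
  · rename_i B hB
    simp only [Bool.and_eq_true] at hrest
    obtain ⟨hE1, hTot⟩ := hrest
    have hmem := rowDBox_mem L Δ lam2 f c a1 a2 pi hB hc hL hΔ0 hΔ1 hf hν1 hν2 ha1 ha2
    have e1 := rexprLeOn_sound hE1 _ hmem
    have eTot := rexprLeOn_sound hTot _ hmem
    simp only [RExpr.eval, cst, vE1, xTrueD_e1] at e1
    push_cast at e1
    have he1 : (τhi : ℝ) - 2 * (eps1 L / (2 * Real.pi / L) ^ 2) ≤ -1 / 1000 := by linarith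
    -- the termwise bound, summed
    have hsum : lowGForm L Δ f ≤ ((L : ℝ) ^ 2) ^ 2 * (2 * Real.pi / L) ^ 2
        * (sumE (lowList.map fun kk => termE τlo τhi kk.1 kk.2)).eval (xTrueD L Δ lam2 f) := by
      rw [lowGForm_eq_listsum L Δ f (by omega)]
      have := listsum_le lowList
        (fun kk => Complex.normSq (cfgDFT L (resid L Δ f) (B1.toTor L kk.1) (B1.toTor L kk.2))
          / (((L : ℝ) ^ 2) ^ 2 * den L (Tplus L Δ f) (B1.toTor L kk.1) (B1.toTor L kk.2)))
        (fun kk => ((L : ℝ) ^ 2) ^ 2 * (2 * Real.pi / L) ^ 2 * (termE τlo τhi kk.1 kk.2).eval (xTrueD L Δ lam2 f))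
        (fun kk hkk => class_le L Δ lam2 f hL hΔ0 hΔ1 hf τlo τhi hτlo hτhi he1 hkk)
      refine this.trans (le_of_eq ?_)
      simp only [eval_sumE, List.map_map, Function.comp_def, List.sum_map_mul_left]
    -- the total check
    simp only [totalE, RExpr.eval, cst, vPi2, vNu, xTrueD_one, xTrueD_two] at eTot
    push_cast at eTot
    -- the right-hand side
    have hRHS : (aD : ℝ) * etaEff L lam2 * Uunit L Δ f
        = ((L : ℝ) ^ 2) ^ 2 * (2 * Real.pi / L) ^ 2 * (3 * aD * (Real.pi ^ 2 * (lam2 / (2 * Real.pi / L) ^ 2)))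
          * (Tplus L Δ f / (2 * Real.pi / L) ^ 2) := by
      have hL0 : (L : ℝ) ≠ 0 := hLpos.ne'
      have hπ : Real.pi ≠ 0 := Real.pi_ne_zero
      unfold Uunit etaEff
      field_simp
      ring
    rw [hRHS]
    have hτ' : (τlo : ℝ) ≤ Tplus L Δ f / (2 * Real.pi / L) ^ 2 := by rw [le_div_iff₀ ht]; exact hτlo
    have hc0 : 0 ≤ ((L : ℝ) ^ 2) ^ 2 * (2 * Real.pi / L) ^ 2 * (3 * aD * (Real.pi ^ 2 * (lam2 / (2 * Real.pi / L) ^ 2))) := by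
      have : (0 : ℝ) ≤ aD := by exact_mod_cast haD
      have hlam : 0 < lam2 := lam2_pos L (by omega) hΔ1 hf.1
      positivity
    have hVt : 0 < ((L : ℝ) ^ 2) ^ 2 * (2 * Real.pi / L) ^ 2 := by positivity
    calc lowGForm L Δ f ≤ ((L : ℝ) ^ 2) ^ 2 * (2 * Real.pi / L) ^ 2
          * (sumE (lowList.map fun kk => termE τlo τhi kk.1 kk.2)).eval (xTrueD L Δ lam2 f) := hsum
      _ ≤ ((L : ℝ) ^ 2) ^ 2 * (2 * Real.pi / L) ^ 2 * ((3 * aD * τlo) * Real.pi ^ 2 * (lam2 / (2 * Real.pi / L) ^ 2)) :=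
          mul_le_mul_of_nonneg_left (by linarith) hVt.le
      _ = ((L : ℝ) ^ 2) ^ 2 * (2 * Real.pi / L) ^ 2 * (3 * aD * (Real.pi ^ 2 * (lam2 / (2 * Real.pi / L) ^ 2))) * τlo := by ring
      _ ≤ _ := mul_le_mul_of_nonneg_left hτ' hc0


/-! ## Per-class variant (one kernel `decide` per class; budgets summed in `ℚ`) -/

/-- ★ the check of ONE class against a rational budget `b`: `(|x_k| + majE)²/(ê_k − τhi) ≤ b` on the row-D box. -/
def classCheck (c : L2.NamedCell) (a1 a2 τlo τhi : ℚ) (pi : ℕ × ℕ) (kk : (ℤ × ℤ) × (ℤ × ℤ)) (b : ℚ) : Bool :=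
  match rowDBox c a1 a2 pi with
  | none => false
  | some B => rexprLeOn (termE τlo τhi kk.1 kk.2) b B pi

/-- ★ the `ê₁` check alone: `τhi − 2ê₁ ≤ −10⁻³` on the row-D box. -/
def e1Check (c : L2.NamedCell) (a1 a2 τhi : ℚ) (pi : ℕ × ℕ) : Bool :=
  match rowDBox c a1 a2 pi with
  | none => false
  | some B => rexprLeOn (.sub (cst τhi) (.mul (cst 2) vE1)) (-1 / 1000) B pi

/-- ★★★ **PER-CLASS FORM**: a budget table `tbl = [(k, b_k)]` listing the classes of `lowList` in order, each row certified by
`classCheck` (one small kernel `decide` per class), with `Σ b_k ≤ 3·(98696/10000)·aD·ν₁·τlo` (`9.8696 < π²`, `ν₁ = n₁/νd` the cell's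
lower `ν`), the `ê₁` check and the `τ` check give `lowG ≤ a_D·η_eff·U` on the cell. -/
theorem lowG_of_classChecks (c : L2.NamedCell) (a1 a2 aD τlo τhi : ℚ) (pi piT : ℕ × ℕ) (tbl : List (((ℤ × ℤ) × (ℤ × ℤ)) × ℚ))
    (htbl : tbl.map Prod.fst = lowList)
    (hcls : (tbl.all fun p => classCheck c a1 a2 τlo τhi pi p.1 p.2) = true)
    (hsum : (tbl.map Prod.snd).sum ≤ 3 * (98696 / 10000) * aD * ((c.n1 : ℚ) / c.νd) * τlo)
    (haD : 0 ≤ aD) (hτlo0 : 0 ≤ τlo) (he1 : e1Check c a1 a2 τhi pi = true) (hτ : tauCheck c a1 a2 τlo τhi piT = true)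
    (hc : c.check = true) (hL : 128 ≤ L)
    (hΔ0 : 0 ≤ Δ) (hΔ1 : Δ < 1) (hf : IsGroundTwoMagnon L Δ lam2 f)
    (hν1 : (c.n1 : ℝ) / c.νd ≤ lam2 / (2 * Real.pi / L) ^ 2) (hν2 : lam2 / (2 * Real.pi / L) ^ 2 ≤ (c.n2 : ℝ) / c.νd)
    (ha1 : ((a1 : ℚ) : ℝ) ≤ Δ * f (K1 L)) (ha2 : Δ * f (K1 L) ≤ ((a2 : ℚ) : ℝ)) :
    lowGForm L Δ f ≤ (aD : ℝ) * etaEff L lam2 * Uunit L Δ f := by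
  have hLpos : (0 : ℝ) < L := by exact_mod_cast (show 0 < L by omega)
  have ht : 0 < (2 * Real.pi / L : ℝ) ^ 2 := by positivity
  have hV : (0 : ℝ) < (L : ℝ) ^ 2 := by positivity
  obtain ⟨hτlo, hτhi⟩ := tau_of_tauCheck L Δ lam2 f c a1 a2 τlo τhi piT hτ hc hL hΔ0 hΔ1 hf hν1 hν2 ha1 ha2
  -- the box and the `ê₁` check
  unfold e1Check at he1
  split at he1
  · exact absurd he1 (by simp)
  · rename_i B hB
    have hmem := rowDBox_mem L Δ lam2 f c a1 a2 pi hB hc hL hΔ0 hΔ1 hf hν1 hν2 ha1 ha2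
    have e1 := rexprLeOn_sound he1 _ hmem
    simp only [RExpr.eval, cst, vE1, xTrueD_e1] at e1
    push_cast at e1
    have he1' : (τhi : ℝ) - 2 * (eps1 L / (2 * Real.pi / L) ^ 2) ≤ -1 / 1000 := by linarith
    -- each row of the table: `term(k) ≤ V²t·termE.eval ≤ V²t·b_k`
    have hcl : ∀ p ∈ tbl,
        Complex.normSq (cfgDFT L (resid L Δ f) (B1.toTor L p.1.1) (B1.toTor L p.1.2))
          / (((L : ℝ) ^ 2) ^ 2 * den L (Tplus L Δ f) (B1.toTor L p.1.1) (B1.toTor L p.1.2))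
        ≤ ((L : ℝ) ^ 2) ^ 2 * (2 * Real.pi / L) ^ 2 * ((p.2 : ℚ) : ℝ) := by
      intro p hp
      have hkk : p.1 ∈ lowList := htbl ▸ List.mem_map_of_mem hp
      have h1 := class_le L Δ lam2 f hL hΔ0 hΔ1 hf τlo τhi hτlo hτhi he1' hkk
      have h2 := List.all_eq_true.mp hcls p hp
      unfold classCheck at h2
      rw [hB] at h2
      have h3 := rexprLeOn_sound h2 _ hmem
      exact h1.trans (mul_le_mul_of_nonneg_left h3 (by positivity))
    have hsum' : lowGForm L Δ f ≤ ((L : ℝ) ^ 2) ^ 2 * (2 * Real.pi / L) ^ 2 * (((tbl.map Prod.snd).sum : ℚ) : ℝ) := by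
      rw [lowGForm_eq_listsum L Δ f (by omega), ← htbl, List.map_map]
      have := listsum_le tbl _ (fun p => ((L : ℝ) ^ 2) ^ 2 * (2 * Real.pi / L) ^ 2 * ((p.2 : ℚ) : ℝ)) hcl
      refine this.trans (le_of_eq ?_)
      rw [List.sum_map_mul_left, Rat.cast_list_sum, List.map_map]
      rfl
    -- the budget inequality in `ℝ`
    have hsumR : (((tbl.map Prod.snd).sum : ℚ) : ℝ) ≤ 3 * (98696 / 10000) * aD * ((c.n1 : ℝ) / c.νd) * τlo := by
      have := (Rat.cast_le (K := ℝ)).mpr hsum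
      push_cast at this ⊢
      exact this
    have hπ2 : (98696 / 10000 : ℝ) ≤ Real.pi ^ 2 := by nlinarith [Real.pi_gt_d6, Real.pi_pos]
    have haD' : (0 : ℝ) ≤ aD := by exact_mod_cast haD
    have hτ0' : (0 : ℝ) ≤ τlo := by exact_mod_cast hτlo0
    have hlam : 0 < lam2 := lam2_pos L (by omega) hΔ1 hf.1
    have hlt : 0 ≤ lam2 / (2 * Real.pi / L) ^ 2 := by positivity
    have hν' : 3 * (98696 / 10000) * (aD : ℝ) * ((c.n1 : ℝ) / c.νd) * τlo
        ≤ 3 * Real.pi ^ 2 * aD * (lam2 / (2 * Real.pi / L) ^ 2) * τlo := by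
      have h1 : 0 ≤ (aD : ℝ) * τlo * (lam2 / (2 * Real.pi / L) ^ 2 - (c.n1 : ℝ) / c.νd) :=
        mul_nonneg (mul_nonneg haD' hτ0') (sub_nonneg.2 hν1)
      have h2 : 0 ≤ (aD : ℝ) * τlo * (lam2 / (2 * Real.pi / L) ^ 2) * (Real.pi ^ 2 - 98696 / 10000) :=
        mul_nonneg (mul_nonneg (mul_nonneg haD' hτ0') hlt) (sub_nonneg.2 hπ2)
      nlinarith [h1, h2]
    have hRHS : (aD : ℝ) * etaEff L lam2 * Uunit L Δ f
        = ((L : ℝ) ^ 2) ^ 2 * (2 * Real.pi / L) ^ 2 * (3 * Real.pi ^ 2 * aD * (lam2 / (2 * Real.pi / L) ^ 2))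
          * (Tplus L Δ f / (2 * Real.pi / L) ^ 2) := by
      have hL0 : (L : ℝ) ≠ 0 := hLpos.ne'
      have hπ : Real.pi ≠ 0 := Real.pi_ne_zero
      unfold Uunit etaEff
      field_simp
      ring
    rw [hRHS]
    have hτ' : (τlo : ℝ) ≤ Tplus L Δ f / (2 * Real.pi / L) ^ 2 := by rw [le_div_iff₀ ht]; exact hτlo
    have hc0 : 0 ≤ ((L : ℝ) ^ 2) ^ 2 * (2 * Real.pi / L) ^ 2 * (3 * Real.pi ^ 2 * aD * (lam2 / (2 * Real.pi / L) ^ 2)) := by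
      positivity
    have hVt : 0 ≤ ((L : ℝ) ^ 2) ^ 2 * (2 * Real.pi / L) ^ 2 := by positivity
    calc lowGForm L Δ f ≤ ((L : ℝ) ^ 2) ^ 2 * (2 * Real.pi / L) ^ 2 * (((tbl.map Prod.snd).sum : ℚ) : ℝ) := hsum'
      _ ≤ ((L : ℝ) ^ 2) ^ 2 * (2 * Real.pi / L) ^ 2 * (3 * Real.pi ^ 2 * aD * (lam2 / (2 * Real.pi / L) ^ 2) * τlo) :=
          mul_le_mul_of_nonneg_left (hsumR.trans (by linarith)) hVt
      _ = ((L : ℝ) ^ 2) ^ 2 * (2 * Real.pi / L) ^ 2 * (3 * Real.pi ^ 2 * aD * (lam2 / (2 * Real.pi / L) ^ 2)) * τlo := by ring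
      _ ≤ _ := mul_le_mul_of_nonneg_left hτ' hc0

end sound

end RowD

end Summit.HubbardSuperconductivity.HubbardSuperconductivity.Theorems.AnisotropyChord.Transfer.Fibre3
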